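import Summits.Ventures.LatticeQCDFlow.Exactness.FlowSamplerGroupSymmetrisationMonotone
import Summits.Ventures.LatticeQCDFlow.Exactness.Phi4FlowLatticeSymmetrisation
import HarnessLib

/-!
# Lattice φ⁴: the FULL symmetry-group average of a flow is never worse than any partial average, on every sign sector of polynomial observables

HONEST FRAMING: exact (Metropolis-corrected) sampling algorithms for lattice gauge theory;
figures of merit are autocorrelation/cost numbers at stated couplings and volumes; no
continuum-physics claim.  (SCALAR calibration rung S0-A: not a gauge result.)

Venture `LatticeQCDFlow` (cell pub-lqcd), topic `Exactness`; FANOUT row 2 (`s0-phi4`, FLOW arm).  NEW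
WORK of the cell: the lattice instance of `FlowSamplerGroupSymmetrisationMonotone` (the full group
average `q̄_G` absorbs every partial average `q̄_S = |ι|⁻¹ Σ_i q̃ ∘ t_{s i}` and is never worse on any
symmetry sector) in the vocabulary of `Phi4LatticeSymmetry` / `Phi4FlowLatticeSymmetrisation`:
`λ > 0`, real `J`, a finite group `G` acting by signed site symmetries `latticeSymm (ρ a) (ε a)`
(`ρ : G →* Perm` with `J (ρ a x) (ρ a y) = J x y`, `ε : G →* ℤˣ`), ANY positive normalised flow `q̃`,
ANY nonempty finite family `s : ι → G` (a subgroup — the translations without the flip, one lattice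
axis —, or a handful of elements):

* **`phi4LatticeAvg_tauInt_le_partialAvg_of_covariant`** — for every `f ∈ PolyObs` in a sign sector
  (`f ∘ t_a = χ(a)·f`, `χ` multiplicative, `χ² = 1`) with `Var f > 0`: if the normalised
  autocorrelation series of `f` under the PARTIALLY averaged flow sampler is summable, then under the
  FULLY averaged one it is summable and `τ_int^{q̄_G}(f) ≤ τ_int^{q̄_S}(f)`;
* `phi4LatticeAvg_tauInt_le_partialAvg_of_invariant` — the invariant case (energy parts, `Σφ²`, `M²`, …).

Nothing is cited as a fact.  NOT CLAIMED: anything off the sectors (`FlowSamplerSymmetrisationMixedParity`);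
two partial averages compared; cost (`|G|` versus `|S|` evaluations of `q̃` per proposal); any value
for any network.
-/

namespace Summit.Ventures.LatticeQCDFlow.Exactness

open Real MeasureTheory Filter Finset Topology
open Summit.Ventures.LatticeQCDFlow.Scoring

section Lattice

variable {n : ℕ} {G : Type*} [Group G] [Fintype G] {ι : Type*} [Fintype ι] [Nonempty ι]

/-- **LATTICE φ⁴: THE FULL SYMMETRY-GROUP AVERAGE IS NEVER WORSE THAN ANY PARTIAL ONE, ON EVERY SIGN
SECTOR.**  `λ > 0`, real `J`, `ρ : G →* Perm` (`J`-automorphisms), `ε : G →* ℤˣ`, ANY positive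
normalised flow `q̃`, `s : ι → G` any nonempty finite family (a subgroup, one axis of translations, a
handful of elements); `f ∈ PolyObs` with `f ∘ t_a = χ(a)·f` (`χ` multiplicative, `χ² = 1`), `Var f > 0`.
If the normalised autocorrelation series of `f` under the PARTIALLY averaged arm is summable, then under
the FULLY averaged arm it is summable and `τ_int^{q̄_G}(f) ≤ τ_int^{q̄_S}(f)`. -/
theorem phi4LatticeAvg_tauInt_le_partialAvg_of_covariant {lam : ℝ} (hlam : 0 < lam)
    {J : Fin (n + 1) → Fin (n + 1) → ℝ} {ρ : G →* Equiv.Perm (Fin (n + 1))}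
    (hJ : ∀ a x y, J (ρ a x) (ρ a y) = J x y) (ε : G →* ℤˣ) (s : ι → G)
    {q : (Fin (n + 1) → ℝ) → ℝ}
    (hq0 : ∀ φ, 0 < q φ) (hqm : Measurable q) (hqi : Integrable q) (hq1 : ∫ φ, q φ = 1)
    {χ : G → ℝ} (hχ : ∀ a b, χ (a * b) = χ a * χ b) (hχ2 : ∀ a, χ a ^ 2 = 1)
    {f : (Fin (n + 1) → ℝ) → ℝ} (hf : PolyObs f)
    (hcov : ∀ a φ, f (latticeSymm (ρ a) (ε a) φ) = χ a * f φ)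
    (hP : 0 < ∫ φ, (f φ - gibbsExpect J lam f) ^ 2 * gibbsWeight J lam φ)
    (hs : Summable fun k => (∫ φ, (f φ - gibbsExpect J lam f)
        * ((imhOpPhi4 J lam
            (fun ψ => (∑ i, q (latticeSymm (ρ (s i)) (ε (s i)) ψ)) / Fintype.card ι))^[k + 1]
            (fun ψ => f ψ - gibbsExpect J lam f)) φ * gibbsWeight J lam φ)
        / ∫ φ, (f φ - gibbsExpect J lam f) ^ 2 * gibbsWeight J lam φ) :
    (Summable fun k => (∫ φ, (f φ - gibbsExpect J lam f)
        * ((imhOpPhi4 J lam (fun ψ => (∑ a, q (latticeSymm (ρ a) (ε a) ψ)) / Fintype.card G))^[k + 1]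
            (fun ψ => f ψ - gibbsExpect J lam f)) φ * gibbsWeight J lam φ)
        / ∫ φ, (f φ - gibbsExpect J lam f) ^ 2 * gibbsWeight J lam φ) ∧
    tauInt (fun k => (∫ φ, (f φ - gibbsExpect J lam f)
        * ((imhOpPhi4 J lam (fun ψ => (∑ a, q (latticeSymm (ρ a) (ε a) ψ)) / Fintype.card G))^[k]
            (fun ψ => f ψ - gibbsExpect J lam f)) φ * gibbsWeight J lam φ)
        / ∫ φ, (f φ - gibbsExpect J lam f) ^ 2 * gibbsWeight J lam φ)
      ≤ tauInt (fun k => (∫ φ, (f φ - gibbsExpect J lam f)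
        * ((imhOpPhi4 J lam
            (fun ψ => (∑ i, q (latticeSymm (ρ (s i)) (ε (s i)) ψ)) / Fintype.card ι))^[k]
            (fun ψ => f ψ - gibbsExpect J lam f)) φ * gibbsWeight J lam φ)
        / ∫ φ, (f φ - gibbsExpect J lam f) ^ 2 * gibbsWeight J lam φ) := by
  haveI : Nonempty G := ⟨s (Classical.arbitrary ι)⟩
  obtain ⟨hgm, hg2⟩ := polyObs_sq_integrable hlam J (polyObs_sub_const hf (gibbsExpect J lam f))
  have hmean : ∀ a, gibbsExpect J lam f = χ a * gibbsExpect J lam f := fun a => by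
    have h := gibbsExpect_comp_latticeSymm (hJ a) (ε a) lam f
    have e : (fun φ => f (latticeSymm (ρ a) (ε a) φ)) = fun φ => χ a * f φ := funext (hcov a)
    rw [e] at h
    calc gibbsExpect J lam f = gibbsExpect J lam (fun φ => χ a * f φ) := h.symm
      _ = χ a * gibbsExpect J lam f := by
          unfold gibbsExpect
          rw [← mul_div_assoc, ← integral_const_mul]
          congr 1
          exact integral_congr_ae (Eventually.of_forall fun φ => by beta_reduce; ring)
  have hcov' : ∀ a φ, (fun ψ => f ψ - gibbsExpect J lam f) (latticeSymm (ρ a) (ε a) φ)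
      = χ a * (fun ψ => f ψ - gibbsExpect J lam f) φ := fun a φ => by
    show f (latticeSymm (ρ a) (ε a) φ) - gibbsExpect J lam f = χ a * (f φ - gibbsExpect J lam f)
    rw [hcov, mul_sub, ← hmean a]
  rw [imhOpPhi4_eq_imhOp] at hs ⊢
  rw [imhOpPhi4_eq_imhOp]
  exact groupAvg_tauInt_le_partialAvg_of_covariant (μ := volume) (s := s)
    (t := fun a => latticeSymm (ρ a) (ε a))
    (latticeSymm_family_measurePreserving ρ ε) (latticeSymm_family_mul ρ ε)
    (fun φ => gibbsWeight_pos J lam φ) (continuous_gibbsWeight J lam).measurable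
    (integrable_gibbsWeight hlam J) (latticeSymm_family_gibbsWeight hJ ε lam) hq0 hqm hqi hq1 hχ hχ2
    hgm hg2 hP hcov' hs


/-- The invariant case (`χ ≡ 1`: energy parts, `Σφ²`, `M²`, every symmetry-averaged local observable):
`τ_int^{q̄_G}(f) ≤ τ_int^{q̄_S}(f)` whenever the partial-average series is summable. -/
theorem phi4LatticeAvg_tauInt_le_partialAvg_of_invariant {lam : ℝ} (hlam : 0 < lam)
    {J : Fin (n + 1) → Fin (n + 1) → ℝ} {ρ : G →* Equiv.Perm (Fin (n + 1))}
    (hJ : ∀ a x y, J (ρ a x) (ρ a y) = J x y) (ε : G →* ℤˣ) (s : ι → G)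
    {q : (Fin (n + 1) → ℝ) → ℝ}
    (hq0 : ∀ φ, 0 < q φ) (hqm : Measurable q) (hqi : Integrable q) (hq1 : ∫ φ, q φ = 1)
    {f : (Fin (n + 1) → ℝ) → ℝ} (hf : PolyObs f)
    (hinv : ∀ a φ, f (latticeSymm (ρ a) (ε a) φ) = f φ)
    (hP : 0 < ∫ φ, (f φ - gibbsExpect J lam f) ^ 2 * gibbsWeight J lam φ)
    (hs : Summable fun k => (∫ φ, (f φ - gibbsExpect J lam f)
        * ((imhOpPhi4 J lam
            (fun ψ => (∑ i, q (latticeSymm (ρ (s i)) (ε (s i)) ψ)) / Fintype.card ι))^[k + 1]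
            (fun ψ => f ψ - gibbsExpect J lam f)) φ * gibbsWeight J lam φ)
        / ∫ φ, (f φ - gibbsExpect J lam f) ^ 2 * gibbsWeight J lam φ) :
    (Summable fun k => (∫ φ, (f φ - gibbsExpect J lam f)
        * ((imhOpPhi4 J lam (fun ψ => (∑ a, q (latticeSymm (ρ a) (ε a) ψ)) / Fintype.card G))^[k + 1]
            (fun ψ => f ψ - gibbsExpect J lam f)) φ * gibbsWeight J lam φ)
        / ∫ φ, (f φ - gibbsExpect J lam f) ^ 2 * gibbsWeight J lam φ) ∧
    tauInt (fun k => (∫ φ, (f φ - gibbsExpect J lam f)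
        * ((imhOpPhi4 J lam (fun ψ => (∑ a, q (latticeSymm (ρ a) (ε a) ψ)) / Fintype.card G))^[k]
            (fun ψ => f ψ - gibbsExpect J lam f)) φ * gibbsWeight J lam φ)
        / ∫ φ, (f φ - gibbsExpect J lam f) ^ 2 * gibbsWeight J lam φ)
      ≤ tauInt (fun k => (∫ φ, (f φ - gibbsExpect J lam f)
        * ((imhOpPhi4 J lam
            (fun ψ => (∑ i, q (latticeSymm (ρ (s i)) (ε (s i)) ψ)) / Fintype.card ι))^[k]
            (fun ψ => f ψ - gibbsExpect J lam f)) φ * gibbsWeight J lam φ)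
        / ∫ φ, (f φ - gibbsExpect J lam f) ^ 2 * gibbsWeight J lam φ) :=
  phi4LatticeAvg_tauInt_le_partialAvg_of_covariant hlam hJ ε s hq0 hqm hqi hq1 (χ := fun _ => (1 : ℝ))
    (fun _ _ => by ring) (fun _ => by ring) hf (fun a φ => by rw [hinv, one_mul]) hP hs

end Lattice

end Summit.Ventures.LatticeQCDFlow.Exactness
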